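import Summits.BirchSwinnertonDyer.BirchSwinnertonDyer.Theorems.PrintCFramBottomClassIndexLawFiveLeEisensteinEndStateV18
import HarnessLib

/-!
# Crux `PrintCFram.BottomClassIndexLawFiveLe` (stmt-BirchSwinnertonDyer-20372), line `eisenstein-resource-bdp-line`: END STATE v19 —
# «C FOR B2′ — THE KRIZ–LI COVER MERGED»: the crux from FOUR refereed print facts + Kriz–Li 2019 Thm 1.20 + ONE arithmetic research statement
# B1 (`BSD_p` on the Eisenstein-irregular members) + ONE number-theoretic research statement C (an admissible Heegner field with unit field factor)

Cell `bsd-print-cfram`, seat `bsd-line-cfram-p1` LEAD g11, `--supports stmt-BirchSwinnertonDyer-20372` (helper). THEOREMS ONLY; no definition, no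
named fact, no `sorry`. BSD is not proved by any of this; no summit statement is proved by this seat; the crux C2 stays OPEN.

Registry v18 (LEAD g10, END STATE `EisensteinEndStateV18.bottomClassIndexLawFiveLe_of_prints4_of_krizLi_of_classFactor_of_noAdmissibleField`,
p669207) carried two research stubs off the Kriz–Li locus: B1 `stub_bsdp_of_classFactor` («non-unit class factor `‖B_{1,ψ⁻¹}‖_p ≤ p⁻¹` ⟹ `BSD_p`»,
arithmetic, inhabited) and B2′ `stub_bsdp_of_noAdmissibleHeegnerField` («unit class factor and NO Heegner field `K''` (d odd < −4) with unit
`K''`-factor ⟹ `BSD_p`», conjecturally vacuous). The ideator line `kriz-li-cover` v2.1 (bsd-idea-7 g12, `Cruxes/…/Lines/kriz_li_cover.lean`, critic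
idea-crit-10 V#120 PASS-WITH-PRICE) typed the vacuity of B2′ as ONE statement C of `GL(1)/ℚ` number theory — «for a class member of analytic rank one with
unit class factor SOME imaginary quadratic `K''` Heegner for `N_W` (`d` odd `< −4`) with a Kronecker character has a UNIT field factor
`¬ ‖B_{1,(ψε_{K''}ω⁻¹)~}‖_p ≤ p⁻¹`» — whose binders are B2′'s and whose conclusion negates B2′'s `∀ K''` premise. Registry v19 (this seat) adopts
C in B2′'s slot. This file records, sorry-free:

* `bsdp_of_noAdmissibleHeegnerField_of_cover` — **C ⟹ B2′** (B2′'s registered v18 type verbatim as conclusion; five lines, `absurd`).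
* `not_exists_characterData_iff_classFactor_of_cover` — **under C, «no Kriz–Li character data at any Heegner field» ⟺ «non-unit class factor»**
  for every class member of analytic rank one and every odd datum `(f, ψ, ω)` with the trace congruence: the off-locus set IS the Eisenstein-irregular
  set (w3 g7's `OffLocusResidue.not_exists_characterData_iff_classFactor_or_forall` with its second alternative killed by C).
* `bottomClassIndexLawFiveLe_of_prints4_of_krizLi_of_classFactor_of_cover` — **END STATE v19: crux ⟸ (FOUR print facts) ∧ (Kriz–Li Thm 1.20) ∧ B1 ∧ C**
  (= END STATE v18 fed with `C ⟹ B2′`).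
* `bsdp_classFactor_of_bottomClassIndexLawFiveLe_of_imcZp` — **B1 is NECESSARY**: crux ∧ (R-IMC)∃-Zp on the class ∧ {modularity, GZ I.(7.3), GZK,
  Cassels} ⟹ `BSD_p` on every rank-one member, in particular B1 verbatim (k7r-c4's `bsdp_of_ramifiedCMBottomClassIndexLawAtZp_of_imcZp` pointwise):
  promoting B1 is not a detour of the line — any proof of C2 proves it.

So after v19 ALL `BSD` content of crux C2 on this line sits in B1; C is analytic number theory one rung above the printed half-integral-weight
non-vanishing ladder (Wiles 2015 Thm 0.0.1 / Beckwith 2017 Thm 1.1: weight 3/2, `ℓ ∉ S`; Bruinier 1999 / Ono–Skinner 1998: no condition at primes of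
the level; Byeon 2003: weight 5/2 without local conditions) — NOT in print for `p ≥ 7` (presearch: w3 g7 `Lines/…-w3g7-B2prime-presearch.md`, idea-7
g12 `Lines/kriz-li-cover.md`, LEAD g11 report). References: Kriz–Li, Forum Math. Sigma 7 (2019) e15, Thm. 1.20, §8, (29); crux workfiles
`Lines/eisenstein_resource_bdp_line.lean` (v19), `Lines/kriz_li_cover.lean` (v2.1), `Lines/eisenstein-resource-bdp-line-lead-g11.md`.
-/

noncomputable section

open scoped Classical Pointwise

set_option linter.dupNamespace false
set_option autoImplicit false

namespace Summit.BirchSwinnertonDyer.BirchSwinnertonDyer.Theorems.PrintCFram.EisensteinEndStateV19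

open WeierstrassCurve NumberField
  Literature.NumberTheory.EllipticCurves
  Literature.NumberTheory.EllipticCurves.Rank1Residual
  Literature.NumberTheory.EllipticCurves.Rank1Residual.Typed
  Literature.NumberTheory.EllipticCurves.KrizLi2019
  Summit.BirchSwinnertonDyer.Rank1Residual
  Summit.BirchSwinnertonDyer.Rank1Residual.X12
  Summit.BirchSwinnertonDyer.BirchSwinnertonDyer.Theses.UniversalToricDescent
  Summit.BirchSwinnertonDyer.BirchSwinnertonDyer.Theorems.PrintCFram

/-- **`C ⟹ B2′`, pointwise and trivially.** If every class member of analytic rank one with a UNIT class factor admits an imaginary quadratic Heegner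
field `K''` of `N_W` (`d_{K''}` odd `< −4`) and a Kronecker character `ε_{K''}` with a UNIT field factor (hypothesis `hC` = registry v19's Stub C
`stub_heegnerField_of_unitClassFactor`, verbatim), then v18's Stub B2′ `stub_bsdp_of_noAdmissibleHeegnerField` holds: its premise «every such `K''` and
`ε_{K''}` has a NON-unit field factor» is contradicted by the field `hC` hands, so its conclusion `BSD_p W p` is reached by `absurd` (B2′ is never used
with content). The text is bsd-idea-7 g12's `KrizLiCover.bsdp_of_noAdmissibleHeegnerField_of_cover` (`Lines/kriz_li_cover.lean` §2), landed here by
the LEAD. BSD is not proved by any of this. [cite: KrizLi2019, Thm. 1.20 (pp. 7–8) and §8 (pp. 49–52)] -/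
theorem bsdp_of_noAdmissibleHeegnerField_of_cover
    (hC :
    ∀ (W : WeierstrassCurve ℚ) [W.IsElliptic] [W.IsGloballyMinimal] (p : ℕ) [Fact p.Prime],
      W.HasCM → CMRamified W p → 5 ≤ p → W.analyticRank = 1 →
      ∀ (f : ℕ) [NeZero f] (ψ : DirichletCharacter ℚ_[p] f) (ω : DirichletCharacter ℚ_[p] p),
        ψ.Odd → KrizLi2019.IsTeichmullerCharacter ω →
        (∀ ℓ : ℕ, ℓ.Prime → ¬ (ℓ ∣ p * W.conductorNorm ℤ) →
          ‖((W.LFunction ℓ : ℤ) : ℚ_[p]) - (ψ (ℓ : ZMod f) + ψ⁻¹ (ℓ : ZMod f) * ω (ℓ : ZMod p))‖ < 1) →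
        ¬ ‖KrizLi2019.bernoulliOnePrim ψ⁻¹‖ ≤ (p : ℝ)⁻¹ →
        ∃ (K : Type) (_ : Field K) (_ : NumberField K) (εK : DirichletCharacter ℚ_[p] (NumberField.discr K).natAbs),
          IsImaginaryQuadratic K ∧ SatisfiesHeegnerHypothesis (W.conductorNorm ℤ) K ∧ Odd (NumberField.discr K) ∧
          NumberField.discr K < -4 ∧ KrizLi2019.IsKroneckerCharacterOf K εK ∧
          ¬ ‖KrizLi2019.bernoulliOnePrim (KrizLi2019.bernoulliCharTwo ψ εK ω)‖ ≤ (p : ℝ)⁻¹) :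
    ∀ (W : WeierstrassCurve ℚ) [W.IsElliptic] [W.IsGloballyMinimal] (p : ℕ) [Fact p.Prime],
      W.HasCM → CMRamified W p → 5 ≤ p → W.analyticRank = 1 →
      ∀ (f : ℕ) [NeZero f] (ψ : DirichletCharacter ℚ_[p] f) (ω : DirichletCharacter ℚ_[p] p),
        ψ.Odd → KrizLi2019.IsTeichmullerCharacter ω →
        (∀ ℓ : ℕ, ℓ.Prime → ¬ (ℓ ∣ p * W.conductorNorm ℤ) →
          ‖((W.LFunction ℓ : ℤ) : ℚ_[p]) - (ψ (ℓ : ZMod f) + ψ⁻¹ (ℓ : ZMod f) * ω (ℓ : ZMod p))‖ < 1) →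
        ¬ ‖KrizLi2019.bernoulliOnePrim ψ⁻¹‖ ≤ (p : ℝ)⁻¹ →
        (∀ (K : Type) [Field K] [NumberField K], IsImaginaryQuadratic K → SatisfiesHeegnerHypothesis (W.conductorNorm ℤ) K →
          Odd (NumberField.discr K) → NumberField.discr K < -4 →
          ∀ εK : DirichletCharacter ℚ_[p] (NumberField.discr K).natAbs, KrizLi2019.IsKroneckerCharacterOf K εK →
            ‖KrizLi2019.bernoulliOnePrim (KrizLi2019.bernoulliCharTwo ψ εK ω)‖ ≤ (p : ℝ)⁻¹) →
        BSDp W p := by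
  intro W _ _ p _ hCM hram h5 hr f _ ψ ω hodd hω hss hcls hall
  obtain ⟨K, iK, iK', εK, hK, hH, hoddK, hd4, hεK, hfld⟩ := hC W p hCM hram h5 hr f ψ ω hodd hω hss hcls
  exact absurd (@hall K iK iK' hK hH hoddK hd4 εK hεK) hfld

/-- **Under C the off-locus set IS the Eisenstein-irregular set.** For a class member `W` (`W/ℚ` globally minimal with CM, `p ≥ 5` CM-ramified) of
analytic rank one and any odd datum `(f, ψ, ω)` with the trace congruence `hss`: granted Stub C (hypothesis `hC`, registry v19 verbatim), «there is NO
Kriz–Li character datum `(K'', f', ψ', ω', ε_{K''})` for `W` at `p`» (the negation of the (KL) case of the composition) holds IF AND ONLY IF the CLASS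
FACTOR is a non-unit, `‖B_{1,ψ⁻¹}‖_p ≤ p⁻¹`. (⟹) w3 g7's `OffLocusResidue.not_exists_characterData_iff_classFactor_or_forall` gives «class factor non-unit
∨ every Heegner `K''` has a non-unit field factor», and the second alternative with a unit class factor contradicts the field `hC` hands; (⟸) the same
iff, first alternative. So with C registered the crux's (¬KL) branch is entered with content ONLY on B1's members. BSD is not proved by any of this.
[cite: KrizLi2019, Thm. 1.20 (pp. 7–8), (29) (pp. 49–50)] -/
theorem not_exists_characterData_iff_classFactor_of_cover
    (hC :
    ∀ (W : WeierstrassCurve ℚ) [W.IsElliptic] [W.IsGloballyMinimal] (p : ℕ) [Fact p.Prime],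
      W.HasCM → CMRamified W p → 5 ≤ p → W.analyticRank = 1 →
      ∀ (f : ℕ) [NeZero f] (ψ : DirichletCharacter ℚ_[p] f) (ω : DirichletCharacter ℚ_[p] p),
        ψ.Odd → KrizLi2019.IsTeichmullerCharacter ω →
        (∀ ℓ : ℕ, ℓ.Prime → ¬ (ℓ ∣ p * W.conductorNorm ℤ) →
          ‖((W.LFunction ℓ : ℤ) : ℚ_[p]) - (ψ (ℓ : ZMod f) + ψ⁻¹ (ℓ : ZMod f) * ω (ℓ : ZMod p))‖ < 1) →
        ¬ ‖KrizLi2019.bernoulliOnePrim ψ⁻¹‖ ≤ (p : ℝ)⁻¹ →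
        ∃ (K : Type) (_ : Field K) (_ : NumberField K) (εK : DirichletCharacter ℚ_[p] (NumberField.discr K).natAbs),
          IsImaginaryQuadratic K ∧ SatisfiesHeegnerHypothesis (W.conductorNorm ℤ) K ∧ Odd (NumberField.discr K) ∧
          NumberField.discr K < -4 ∧ KrizLi2019.IsKroneckerCharacterOf K εK ∧
          ¬ ‖KrizLi2019.bernoulliOnePrim (KrizLi2019.bernoulliCharTwo ψ εK ω)‖ ≤ (p : ℝ)⁻¹)
    (W : WeierstrassCurve ℚ) [W.IsElliptic] [W.IsGloballyMinimal] (p : ℕ) [Fact p.Prime]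
    (hCM : W.HasCM) (hram : CMRamified W p) (h5 : 5 ≤ p) (hr : W.analyticRank = 1)
    {f : ℕ} [NeZero f] (ψ : DirichletCharacter ℚ_[p] f) (ω : DirichletCharacter ℚ_[p] p) (hψ : ψ.Odd)
    (hω : KrizLi2019.IsTeichmullerCharacter ω)
    (hss : ∀ ℓ : ℕ, ℓ.Prime → ¬ (ℓ ∣ p * W.conductorNorm ℤ) →
      ‖((W.LFunction ℓ : ℤ) : ℚ_[p]) - (ψ (ℓ : ZMod f) + ψ⁻¹ (ℓ : ZMod f) * ω (ℓ : ZMod p))‖ < 1) :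
    (¬ ∃ (K : Type) (_ : Field K) (_ : NumberField K)
      (f : ℕ) (_ : NeZero f) (ψ : DirichletCharacter ℚ_[p] f) (ω : DirichletCharacter ℚ_[p] p)
      (εK : DirichletCharacter ℚ_[p] (NumberField.discr K).natAbs),
      IsImaginaryQuadratic K ∧ SatisfiesHeegnerHypothesis (W.conductorNorm ℤ) K ∧ Odd (NumberField.discr K) ∧
      NumberField.discr K < -4 ∧ ψ.IsPrimitive ∧ KrizLi2019.IsTeichmullerCharacter ω ∧
      (∀ ℓ : ℕ, ℓ.Prime → ¬ (ℓ ∣ p * W.conductorNorm ℤ) →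
        ‖((W.LFunction ℓ : ℤ) : ℚ_[p]) - (ψ (ℓ : ZMod f) + ψ⁻¹ (ℓ : ZMod f) * ω (ℓ : ZMod p))‖ < 1) ∧
      ψ (p : ZMod f) ≠ 1 ∧ KrizLi2019.primVal (KrizLi2019.invMulOmega ψ ω) p ≠ 1 ∧
      (∀ ℓ : ℕ, (hℓ : ℓ.Prime) → ℓ ≠ p →
        (haveI := Fact.mk hℓ; ¬ W.HasGoodReductionAtPrime ℓ ∧ ¬ W.HasMultiplicativeReductionAtPrime ℓ) →
        ψ (ℓ : ZMod f) ≠ 1 ∧ KrizLi2019.primVal (KrizLi2019.invMulOmega ψ ω) ℓ ≠ 1) ∧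
      KrizLi2019.IsKroneckerCharacterOf K εK ∧
      ¬ (‖KrizLi2019.bernoulliOnePrim (KrizLi2019.bernoulliCharOne ψ εK) *
          KrizLi2019.bernoulliOnePrim (KrizLi2019.bernoulliCharTwo ψ εK ω)‖ ≤ (p : ℝ)⁻¹)) ↔
    ‖KrizLi2019.bernoulliOnePrim ψ⁻¹‖ ≤ (p : ℝ)⁻¹ := by
  rw [Theorems.PrintCFram.OffLocusResidue.not_exists_characterData_iff_classFactor_or_forall W p hCM hram h5 ψ ω hψ hω hss]
  constructor
  · rintro (hcls | hall)
    · exact hcls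
    · by_contra hcls
      obtain ⟨K, iK, iK', εK, hK, hH, hoddK, hd4, hεK, hfld⟩ := hC W p hCM hram h5 hr f ψ ω hψ hω hss hcls
      exact hfld (@hall K iK iK' hK hH hoddK hd4 εK hεK)
  · exact Or.inl

/-- **END STATE v19 of line `eisenstein-resource-bdp-line` on crux C2 `BottomClassIndexLawFiveLe` («C for B2′ — the Kriz–Li cover merged»).** The crux
follows from: (1) `hprints4` — FOUR print facts (Hsieh 2014 Thm. A any level; Liu–Zhang–Zhang 2018 Thms 1.5.1/1.5.3; `ToricPublishedInputs`; Burungale–Flach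
2024 Cor. 2); (2) `hKL` — Kriz–Li 2019 Thm. 1.20; (3) `hB1` — `BSD_p(W)` for class members whose odd Kriz–Li character has a NON-UNIT class factor
(registry v19's `stub_bsdp_of_classFactor`, verbatim; the ARITHMETIC residue — BKNO 2026 §1.4, barrier `CMRankOneAtRamifiedPrime`; inhabited by 17424bl1@11,
305809c1@7); (4) `hC` — for class members of analytic rank one with a UNIT class factor, an imaginary quadratic Heegner field `K''` of `N_W` (`d` odd `< −4`)
with a Kronecker character and a UNIT field factor EXISTS (registry v19's `stub_heegnerField_of_unitClassFactor`, verbatim; the NUMBER-THEORETIC residue,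
no `BSD` in it). Proof: END STATE v18 (`EisensteinEndStateV18.bottomClassIndexLawFiveLe_of_prints4_of_krizLi_of_classFactor_of_noAdmissibleField`,
p669207: split on character data; (KL) print + Kriz–Li via the MW-free Road C; (¬KL) class-factor split) with its fourth hypothesis B2′ supplied by
`bsdp_of_noAdmissibleHeegnerField_of_cover hC`. CONDITIONAL on (1)–(4); BSD is not proved by any of this; the crux stays OPEN.
[cite: KrizLi2019, Thm. 1.20 (pp. 7–8), Rem. 1.21 (p. 8), §7.1 (p. 43), §8 (pp. 49–52)] [cite: BurungaleKobayashiNakamuraOta2026, §1.4 (arXiv:2608.06879 p. 8)] -/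
theorem bottomClassIndexLawFiveLe_of_prints4_of_krizLi_of_classFactor_of_cover
    (hprints4 :
    Hsieh2014.thmA_exists_isHsiehLFunction_unrPeriod_anyLevel ∧
    LiuZhangZhang2018.thm151_thm153_modularCurve_heegnerVector_additive ∧
    ToricPublishedInputs ∧
    bsdTriple_of_hasCM_of_L_one_ne_zero)
    (hKL : KrizLi2019.thm120_padicLogHeegner_unit_of_bernoulli)
    (hB1 :
    ∀ (W : WeierstrassCurve ℚ) [W.IsElliptic] [W.IsGloballyMinimal] (p : ℕ) [Fact p.Prime],
      W.HasCM → CMRamified W p → 5 ≤ p → W.analyticRank = 1 →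
      ∀ (f : ℕ) [NeZero f] (ψ : DirichletCharacter ℚ_[p] f) (ω : DirichletCharacter ℚ_[p] p),
        ψ.Odd → KrizLi2019.IsTeichmullerCharacter ω →
        (∀ ℓ : ℕ, ℓ.Prime → ¬ (ℓ ∣ p * W.conductorNorm ℤ) →
          ‖((W.LFunction ℓ : ℤ) : ℚ_[p]) - (ψ (ℓ : ZMod f) + ψ⁻¹ (ℓ : ZMod f) * ω (ℓ : ZMod p))‖ < 1) →
        ‖KrizLi2019.bernoulliOnePrim ψ⁻¹‖ ≤ (p : ℝ)⁻¹ →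
        BSDp W p)
    (hC :
    ∀ (W : WeierstrassCurve ℚ) [W.IsElliptic] [W.IsGloballyMinimal] (p : ℕ) [Fact p.Prime],
      W.HasCM → CMRamified W p → 5 ≤ p → W.analyticRank = 1 →
      ∀ (f : ℕ) [NeZero f] (ψ : DirichletCharacter ℚ_[p] f) (ω : DirichletCharacter ℚ_[p] p),
        ψ.Odd → KrizLi2019.IsTeichmullerCharacter ω →
        (∀ ℓ : ℕ, ℓ.Prime → ¬ (ℓ ∣ p * W.conductorNorm ℤ) →
          ‖((W.LFunction ℓ : ℤ) : ℚ_[p]) - (ψ (ℓ : ZMod f) + ψ⁻¹ (ℓ : ZMod f) * ω (ℓ : ZMod p))‖ < 1) →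
        ¬ ‖KrizLi2019.bernoulliOnePrim ψ⁻¹‖ ≤ (p : ℝ)⁻¹ →
        ∃ (K : Type) (_ : Field K) (_ : NumberField K) (εK : DirichletCharacter ℚ_[p] (NumberField.discr K).natAbs),
          IsImaginaryQuadratic K ∧ SatisfiesHeegnerHypothesis (W.conductorNorm ℤ) K ∧ Odd (NumberField.discr K) ∧
          NumberField.discr K < -4 ∧ KrizLi2019.IsKroneckerCharacterOf K εK ∧
          ¬ ‖KrizLi2019.bernoulliOnePrim (KrizLi2019.bernoulliCharTwo ψ εK ω)‖ ≤ (p : ℝ)⁻¹) :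
    Summit.BirchSwinnertonDyer.BirchSwinnertonDyer.Theses.PrintCFram.BottomClassIndexLawFiveLe :=
  EisensteinEndStateV18.bottomClassIndexLawFiveLe_of_prints4_of_krizLi_of_classFactor_of_noAdmissibleField hprints4 hKL hB1
    (bsdp_of_noAdmissibleHeegnerField_of_cover hC)

/-- **B1 is NECESSARY, not an artefact of the line: the crux itself, granted the elliptic-unit main-conjecture identity (R-IMC)∃-Zp on
the class and the four classical named facts (modularity, Gross–Zagier I.(7.3), GZK, Cassels), returns `BSD_p(W)` for EVERY class member of
analytic rank one — in particular registry v19's Stub B1 verbatim (its Bernoulli premise is not even used).** Pointwise k7r-c4's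
`RubinFormulaZpBsdp.bsdp_of_ramifiedCMBottomClassIndexLawAtZp_of_imcZp` at the crux's conclusion `RamifiedCMBottomClassIndexLawAtZp W p`. So
(modulo IMC and the named facts) the crux and «`BSD_p` on the class» are the same statement, and promoting B1 to an item is the honest residue:
any proof of C2 proves B1. BSD is not proved by any of this. [cite: BurungaleKobayashiNakamuraOta2026, Thm. 3.14 (3) and §1.4 (arXiv:2608.06879 pp. 22–24, 8)]
[cite: Miller2011LMS, Def. 1.1 (arXiv:1010.2431 p. 3)] -/
theorem bsdp_classFactor_of_bottomClassIndexLawFiveLe_of_imcZp (hmod : hasEntireLFunction_rat)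
    (hGZ : GrossZagier1986_thm_I_7_3) (hGZK : rank_eq_analyticRank_of_analyticRank_le_one)
    (hCassels : bsdRHS_eq_of_isIsogenous)
    (hIMC : ∀ (W : WeierstrassCurve ℚ) [W.IsElliptic] [W.IsGloballyMinimal] (p : ℕ) [Fact p.Prime],
      W.HasCM → CMRamified W p → 5 ≤ p → W.analyticRank = 1 → O11.RamifiedCMEllipticUnitIMCAtZp W p)
    (hcrux : Summit.BirchSwinnertonDyer.BirchSwinnertonDyer.Theses.PrintCFram.BottomClassIndexLawFiveLe) :
    ∀ (W : WeierstrassCurve ℚ) [W.IsElliptic] [W.IsGloballyMinimal] (p : ℕ) [Fact p.Prime],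
      W.HasCM → CMRamified W p → 5 ≤ p → W.analyticRank = 1 →
      ∀ (f : ℕ) [NeZero f] (ψ : DirichletCharacter ℚ_[p] f) (ω : DirichletCharacter ℚ_[p] p),
        ψ.Odd → KrizLi2019.IsTeichmullerCharacter ω →
        (∀ ℓ : ℕ, ℓ.Prime → ¬ (ℓ ∣ p * W.conductorNorm ℤ) →
          ‖((W.LFunction ℓ : ℤ) : ℚ_[p]) - (ψ (ℓ : ZMod f) + ψ⁻¹ (ℓ : ZMod f) * ω (ℓ : ZMod p))‖ < 1) →
        ‖KrizLi2019.bernoulliOnePrim ψ⁻¹‖ ≤ (p : ℝ)⁻¹ →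
        BSDp W p := by
  intro W _ _ p _ hCM hram h5 hr f _ ψ ω _ _ _ _
  exact RamifiedSevenEllipticUnits.RubinFormulaZpBsdp.bsdp_of_ramifiedCMBottomClassIndexLawAtZp_of_imcZp hmod hGZ hGZK hCassels
    (hIMC W p hCM hram h5 hr) hCM hram h5 hr (hcrux hGZK W p hCM hram h5 hr)

end Summit.BirchSwinnertonDyer.BirchSwinnertonDyer.Theorems.PrintCFram.EisensteinEndStateV19

end
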